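import Summits.ValiantsHypothesis.ValiantsHypothesis.Theorems.DivisionGapPerDivisionHardStubColContentRigid

/-!
# Crux `DivisionGap.PerDivisionHard` (stmt-ValiantsHypothesis-5065), line `pair-descent-jss-endpoint` —
stub `stub_colContentSubexpRigid`: K2 for cofactors of COLUMN-CONTENT RANK `≤ 2^{n/(log₂ n+e)^e}`
across a balanced row cut

For a row set `A ⊆ Fin n` and an exponent vector `m` let `colContent_A(m) := (Σ_{r ∈ A} m(r,c))_c`
and `V_A(h) := {colContent_A(m) : m ∈ supp h}` (the `Finset.image` of `fun m c => ∑ r ∈ A, m (r, c)`).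

`stub_colContentSubexpRigid`: for all `d` there are `e n₀` such that for `n ≥ n₀` every nonzero
torus-homogeneous `h ∈ ℝ≥0[x_ij]` with `|V_A(h)| ≤ 2^{n/(log₂ n + e)^e}` for a row set `A` with
`n ≤ 4|A| ≤ 3n` admits a placement `eR eC` of the block arsenal `G(b,k) ⊕ M₀` with
`b ≥ (log₂ n + d)^d`, a weight `w` cutting out the placed face of the Birkhoff polytope, and a
single `G`-part `u` of its top-`w` fibre.

This is `stub_colContentRigid` (`Theorems/DivisionGapPerDivisionHardStubColContentRigid.lean`)
verbatim with LONG subdivision paths (as `stub_subexpRigid` is to `stub_sparseRigid`).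
Parameters: `L = log₂ n`, `q = (L + d + 1)^{d+1}`, `b = q`, `k = n / (16q²)` (so `k ≥ q ≥ 2` once
`n ≥ 16q³`), `N = q + q²k` core labels (so `4N ≤ n` and `2N + (k - 1) ≤ n`), threshold
`t₀ = k - 1`, `e = 2d + 8` (so `(L + e)^e ≥ 64q²`, whence `n / (L + e)^e ≤ k / 4` and
`|V_A(h)|² ≤ 2^{2 (n/(L+e)^e)} ≤ 2^{k-1}`).
1. ROWS ALTERNATE (`stub_altRowEquiv`): label the rows so that the internal row `(i, j, t)` of
   every subdivision path lies in `A` iff `t` is even (room: `N ≤ |A|`, `N ≤ n - |A|`).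
2. COLUMNS BY COUNTING (`exists_goodSubset`, `count_lt`): for an ordered pair `(v₁, v₂)` of values
   of `V_A(h)` let `T(v₁, v₂)` be the set of columns where they differ; the pairs with
   `|T| ≥ k - 1` are at most `|V_A(h)|² ≤ 2^{k-1}`, so some `N`-set `S` of columns contains no
   such `T`; label the columns so that the core and internal labels land in `S`
   (`exists_blockEquiv`).
3. The generic weight cuts out the placed face `G` (`cutsOut_genericWeight`, the diagonal perfect
   matching `exists_blockMatching`) and its top fibre agrees off `G`
   (`eq_offG_of_mem_support_topComponent`).
4. Two fibre monomials `m₁ ≠ m₂` differ by an integer matrix `D` supported on `G` with vanishing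
   row and column sums; ALTERNATION DETECTS IT (`stub_altFlow`): the `A`-column-sums of `D` — the
   differences of the `A`-column contents `v₁, v₂` of `m₁, m₂` — are nonzero on `≥ k - 1`
   columns, none of them a padding column, i.e. `T(v₁, v₂) ⊆ S` with `|T| ≥ k - 1`: excluded
   by 2.  So the top fibre is a single monomial `m₀`, and `u = m₀|_G`.
-/

noncomputable section

-- `Summit.ValiantsHypothesis.ValiantsHypothesis.…` is the tree's mandated single-conjunct layout
-- (Sub = Summit), so the duplicated namespace component is intended.
set_option linter.dupNamespace false

namespace Summit.ValiantsHypothesis.ValiantsHypothesis.Theorems.DivisionGapPerDivisionHard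

open MvPolynomial Literature.Computability.AlgebraicComplexity
open Summit.ValiantsHypothesis.ValiantsHypothesis.Theorems.ZeroOneTransfer.Negative
open scoped NNReal


variable {n : ℕ}

/-- The exponent bookkeeping of `stub_colContentSubexpRigid`: with `q = (L + d + 1)^{d+1}` and
`e = 2d + 8`, `64q² ≤ (L + e)^e`. [folklore] -/
theorem sixtyfour_mul_sq_le_pow (L d : ℕ) :
    64 * ((L + d + 1) ^ (d + 1) * (L + d + 1) ^ (d + 1)) ≤ (L + (2 * d + 8)) ^ (2 * d + 8) := by
  have h1 : (L + d + 1) ^ (d + 1) ≤ (L + (2 * d + 8)) ^ (d + 1) :=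
    Nat.pow_le_pow_left (by omega) _
  have h2 : 64 ≤ (L + (2 * d + 8)) ^ 2 :=
    calc 64 = 8 ^ 2 := by norm_num
      _ ≤ (L + (2 * d + 8)) ^ 2 := Nat.pow_le_pow_left (by omega) 2
  calc 64 * ((L + d + 1) ^ (d + 1) * (L + d + 1) ^ (d + 1))
      ≤ (L + (2 * d + 8)) ^ 2 * ((L + (2 * d + 8)) ^ (d + 1) * (L + (2 * d + 8)) ^ (d + 1)) :=
        Nat.mul_le_mul h2 (Nat.mul_le_mul h1 h1)
    _ = (L + (2 * d + 8)) ^ (2 * d + 4) := by ring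
    _ ≤ (L + (2 * d + 8)) ^ (2 * d + 8) := Nat.pow_le_pow_right (by omega) (by omega)

/-- **`stub_colContentSubexpRigid` (K2 of line `pair-descent-jss-endpoint` for cofactors of
column-content rank `≤ 2^{n/(log₂ n+e)^e}` across a balanced row cut).**  For all `d` there are
`e n₀` such that for `n ≥ n₀` every nonzero torus-homogeneous `h ∈ ℝ≥0[x_ij]` whose monomials have
at most `2^{n/(log₂ n + e)^e}` distinct `A`-column-content vectors `(Σ_{r∈A} m(r,c))_c` on a row
set `A` with `n ≤ 4|A| ≤ 3n` admits a placement `eR eC` of `G(b,k) ⊕ M₀` with `(log₂ n + d)^d ≤ b`,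
a weight `w` cutting out the placed face, and a single `G`-part `u` of the top-`w` fibre of `h`
(which is in fact a single monomial).  `stub_colContentRigid` with long subdivision paths
`k = n / (16q²)`, `b = q = (log₂ n + d + 1)^{d+1}`, `e = 2d + 8`: rows alternate along every
subdivision path (`stub_altRowEquiv`), core columns by counting over the `≤ 2^{k-1}` ordered pairs
of column-content values (`exists_goodSubset`), generic weight, and alternation detects
circulations on `≥ k - 1` core columns (`stub_altFlow`). [folklore] -/
theorem stub_colContentSubexpRigid :
    ∀ d : ℕ, ∃ e n₀ : ℕ, ∀ n ≥ n₀, ∀ h : MvPolynomial (Fin n × Fin n) ℝ≥0,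
      h ≠ 0 → IsTorusHomogeneous h → ∀ A : Finset (Fin n), n ≤ 4 * A.card → 4 * A.card ≤ 3 * n →
      (h.support.image fun (mm : (Fin n × Fin n) →₀ ℕ) (cc : Fin n) => ∑ r ∈ A, mm (r, cc)).card ≤
          2 ^ (n / (Nat.log 2 n + e) ^ e) →
      ∃ (b k m : ℕ) (eR eC : BlockV b k m ≃ Fin n) (w : Fin n × Fin n → ℕ)
        (u : (Fin n × Fin n) →₀ ℕ),
        (Nat.log 2 n + d) ^ d ≤ b ∧ CutsOut w (placedBlock eR eC) ∧
          HasSingleGPart (placedBlock eR eC) w h u := by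
  intro d
  obtain ⟨L₀, hL₀⟩ := growth d
  refine ⟨2 * d + 8, 2 ^ (L₀ + 1), fun n hn h hh htor A hA₁ hA₂ hcard => ?_⟩
  classical
  -- the parameters
  have hn0 : n ≠ 0 := by
    have : 1 ≤ 2 ^ (L₀ + 1) := Nat.one_le_two_pow
    omega
  have hLL₀ : L₀ + 1 ≤ Nat.log 2 n := Nat.le_log_of_pow_le one_lt_two hn
  have h2L : 2 ^ Nat.log 2 n ≤ n := Nat.pow_log_le_self 2 hn0
  have hq16 := hL₀ (Nat.log 2 n) (by omega)
  have he := sixtyfour_mul_sq_le_pow (Nat.log 2 n) d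
  set L := Nat.log 2 n with hL
  have hy : 2 ≤ L + d + 1 := by omega
  have hdq : (L + d) ^ d ≤ (L + d + 1) ^ (d + 1) :=
    (Nat.pow_le_pow_left (by omega) d).trans (Nat.pow_le_pow_right (by omega) (by omega))
  have hq2 : 2 ≤ (L + d + 1) ^ (d + 1) :=
    (Nat.le_self_pow (Nat.succ_ne_zero _) 2).trans (Nat.pow_le_pow_left hy _)
  set q := (L + d + 1) ^ (d + 1) with hq
  have hn16 : 16 * (q * (q * q)) ≤ n := hq16.trans h2L
  have hqq : 4 ≤ q * q := Nat.mul_le_mul hq2 hq2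
  have hq3 : q ≤ q * (q * q) := Nat.le_mul_of_pos_right q (by omega)
  -- the subdivision length `k = n / (16q²)`
  have h16qq : 0 < 16 * (q * q) := by omega
  have hqk : q ≤ n / (16 * (q * q)) :=
    (Nat.le_div_iff_mul_le h16qq).mpr
      (calc q * (16 * (q * q)) = 16 * (q * (q * q)) := by ring
        _ ≤ n := hn16)
  have hX : 16 * (q * (q * (n / (16 * (q * q))))) ≤ n :=
    calc 16 * (q * (q * (n / (16 * (q * q))))) = n / (16 * (q * q)) * (16 * (q * q)) := by ring
      _ ≤ n := Nat.div_mul_le_self n (16 * (q * q))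
  have hke : n / (L + (2 * d + 8)) ^ (2 * d + 8) ≤ n / (16 * (q * q)) / 4 :=
    calc n / (L + (2 * d + 8)) ^ (2 * d + 8) ≤ n / (64 * (q * q)) :=
          Nat.div_le_div_left he (by omega)
      _ = n / (16 * (q * q) * 4) := by rw [show 64 * (q * q) = 16 * (q * q) * 4 by ring]
      _ = n / (16 * (q * q)) / 4 := (Nat.div_div_eq_div_mul n _ 4).symm
  set k := n / (16 * (q * q)) with hkdef
  have hk : 0 < k := by omega
  have hkX : k ≤ q * (q * k) := by
    rw [← Nat.mul_assoc]
    exact Nat.le_mul_of_pos_left k (by omega)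
  set N := q + q * (q * k) with hN
  have hNn : 4 * N ≤ n := by omega
  -- the column-content map and the bad pairs of its values
  set colA : ((Fin n × Fin n) →₀ ℕ) → (Fin n → ℕ) := fun mm cc => ∑ r ∈ A, mm (r, cc) with hcolA
  set V := h.support.image colA with hV
  let T : (Fin n → ℕ) × (Fin n → ℕ) → Finset (Fin n) := fun p =>
    Finset.univ.filter fun cc => p.1 cc ≠ p.2 cc
  set P := (V ×ˢ V).filter fun p => k - 1 ≤ (T p).card with hP
  have hPcard : P.card ≤ 2 ^ (k - 1) :=
    calc P.card ≤ (V ×ˢ V).card := Finset.card_filter_le _ _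
      _ = V.card * V.card := Finset.card_product _ _
      _ ≤ 2 ^ (n / (L + (2 * d + 8)) ^ (2 * d + 8)) * 2 ^ (n / (L + (2 * d + 8)) ^ (2 * d + 8)) :=
          Nat.mul_le_mul hcard hcard
      _ = 2 ^ (2 * (n / (L + (2 * d + 8)) ^ (2 * d + 8))) := by rw [← pow_add, ← two_mul]
      _ ≤ 2 ^ (k - 1) := Nat.pow_le_pow_right two_pos (by omega)
  -- a good set `S` of `N` core columns and the column labelling
  obtain ⟨S, hScard, hSgood⟩ := exists_goodSubset P T N (k - 1)
    (fun p hp => (Finset.mem_filter.mp hp).2)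
    (by rw [Fintype.card_fin]; exact count_lt (by omega) (by omega) hPcard (by omega))
  obtain ⟨eC, heC₁, heC₂⟩ :=
    exists_blockEquiv S q k (n - N) hScard (by rw [hScard])
  -- the alternating row labelling
  obtain ⟨eR, halt⟩ := stub_altRowEquiv q k (n - N) n A (by omega) (by omega) (by omega)
  set G := placedBlock eR eC with hG
  set B := h.totalDegree + 1 with hB
  -- the generic weight cuts out `G`
  obtain ⟨g, hg⟩ := exists_blockMatching q k (n - N) hk
  obtain ⟨σ₀, hσ₀⟩ := exists_perm_mem_placedBlock eR eC g hg
  have hcut : CutsOut (genericWeight G B) G := cutsOut_genericWeight G (Nat.succ_pos _) σ₀ hσ₀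
  -- the top fibre is a single monomial
  have hfib : ∀ m₁ ∈ (topComponent (genericWeight G B) h).support,
      ∀ m₂ ∈ (topComponent (genericWeight G B) h).support, m₁ = m₂ := by
    intro m₁ hm₁ m₂ hm₂
    have hs₁ := support_topComponent_subset _ h hm₁
    have hs₂ := support_topComponent_subset _ h hm₂
    obtain ⟨r₀, c₀, hrc⟩ := htor
    have hoff := eq_offG_of_mem_support_topComponent G hm₁ hm₂
      (degree_eq_of_rowDegrees_eq ((hrc m₁ hs₁).1.trans (hrc m₂ hs₂).1.symm))
    by_contra hne
    -- the difference `D = m₁ - m₂`: supported on `G`, vanishing margins, nonzero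
    obtain ⟨hrow, hcol⟩ := sum_diff_eq_zero ((hrc m₁ hs₁).1.trans (hrc m₂ hs₂).1.symm)
      ((hrc m₁ hs₁).2.trans (hrc m₂ hs₂).2.symm)
    set D : Fin n × Fin n → ℤ := fun e => (m₁ e : ℤ) - m₂ e with hD
    have hDG : ∀ e, D e ≠ 0 → e ∈ G := fun e he => by
      by_contra heG
      exact he (by simp only [hD, hoff e heG, sub_self])
    have hDne : ∃ e, D e ≠ 0 := by
      by_contra hall
      push Not at hall
      exact hne (Finsupp.ext fun e => by exact_mod_cast sub_eq_zero.mp (hall e))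
    obtain ⟨hcols, hnotpad⟩ := stub_altFlow q k (n - N) n eR eC A D hk hDG hrow hcol halt hDne
    -- the two column contents form a bad pair whose difference set lies inside `S`
    have hTeq : T (colA m₁, colA m₂) = Finset.univ.filter fun cc => ∑ r ∈ A, D (r, cc) ≠ 0 := by
      refine Finset.filter_congr fun cc _ => ?_
      change (∑ r ∈ A, m₁ (r, cc) ≠ ∑ r ∈ A, m₂ (r, cc)) ↔ _
      rw [← colContent_sub_eq_sum A m₁ m₂ cc, sub_ne_zero, Nat.cast_injective.ne_iff]
    have hmem : (colA m₁, colA m₂) ∈ P := by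
      refine Finset.mem_filter.mpr ⟨Finset.mk_mem_product (Finset.mem_image_of_mem _ hs₁)
        (Finset.mem_image_of_mem _ hs₂), ?_⟩
      rw [hTeq]
      exact hcols
    refine hSgood _ hmem fun cc hcc => ?_
    rw [hTeq] at hcc
    have hcc' := (Finset.mem_filter.mp hcc).2
    obtain ⟨x, rfl⟩ := eC.surjective cc
    rcases x with i | p | u
    · exact heC₁ i
    · exact heC₂ p
    · exact absurd (eC.symm_apply_apply _) (hnotpad _ u hcc')
  -- conclusion: `u` is the `G`-part of the unique monomial of the top fibre
  obtain ⟨m₀, hm₀⟩ := support_nonempty.mpr (topComponent_ne_zero (genericWeight G B) hh)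
  refine ⟨q, k, n - N, eR, eC, genericWeight G B, m₀.filter (· ∈ G), hdq, hcut,
    fun e he => ?_, fun m' hm' e he => ?_⟩
  · rw [Finsupp.support_filter] at he
    exact (Finset.mem_filter.mp he).2
  · rw [hfib m' hm' m₀ hm₀, Finsupp.filter_apply_pos _ _ he]

end Summit.ValiantsHypothesis.ValiantsHypothesis.Theorems.DivisionGapPerDivisionHard

end
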